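import Summits.PneNP.PneNP.Theorems.SoloBlindStreamCollapse
import Literature.Computability.MetaComplexity.McKayMurrayWilliams2019.UniformStreaming
import Literature.Computability.Complexity.CNF
import HarnessLib

/-!
# The non-uniform one-pass class at space `N` is everything

Upper end of the calibration of the summit's streaming form (THEOREM E,
`SoloBlindStreamingCompleteness`; THEOREM F, `SoloBlindStreamingFooling`): in the tree's typed
one-pass model, the NON-UNIFORM class `STREAM S T` with space `S N = N` (and the canonical update
time `5 N + 10` of the table machines of `SoloBlindStreamCollapse`) contains EVERY language
(`STREAM_id_eq_univ`): the truncating buffer (state = the prefix read, never longer than `N`;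
acceptance = membership of the buffer) satisfies the closure-style space predicate `HasSpace`, and
`mem_STREAM_of_hasSpace` supplies the update machines.  Together with THEOREM F (`SAT ∉ STREAM S T`
whenever `S N · (16 ⌊log₂ N⌋ + 74) < N` eventually, for every `T`) this pins the one-pass space
threshold of `SAT` — for time-insensitive, uniformity-insensitive arguments — inside
`[N / (16 log₂ N + 74), N]`; above it only the uniform classes `USTREAM (N^k + k) (N^k + k)` of
THEOREM E carry content, and that content is the time complexity of `SAT`, i.e. the summit.

References: folklore (buffering); the model is that of D. M. McKay, C. D. Murray, R. R. Williams,
STOC 2019, §2, as typed in `Literature.Computability.MetaComplexity.Magnification`.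
-/

namespace Summit.PneNP.PneNP.Theorems.SoloBlind

open Computability
open Literature.Computability.Complexity Literature.Computability.MetaComplexity
open Literature.Computability.MetaComplexity.McKayMurrayWilliams2019

namespace TBuf

/-- The TRUNCATING buffer of a language `L`: empty initial state; the state is the prefix read,
frozen once it has length `N`; acceptance is membership of the buffer in `L`. [folklore] -/
noncomputable def truncBuffer (L : Language Bool) : StreamingAlgorithm where
  init := fun _ => []
  update := fun N σ b => if σ.length < N then σ ++ [b] else σ
  accept := fun _ σ => L.boolIndicator σ

/-- The truncating buffer has space `N` in the closure sense of `HasSpace`. [folklore] -/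
theorem hasSpace_truncBuffer (L : Language Bool) : (truncBuffer L).HasSpace fun N => N := by
  intro N
  refine ⟨by simp [truncBuffer], fun st b hst => ?_⟩
  simp only [truncBuffer]
  split_ifs with h
  · simp only [List.length_append, List.length_singleton]; omega
  · exact hst

/-- On a prefix of length `≤ N` the truncating buffer holds exactly the prefix. [folklore] -/
theorem reach_truncBuffer (L : Language Bool) (N : ℕ) :
    ∀ x : List Bool, x.length ≤ N → reach (truncBuffer L) N x = x := by
  intro x
  induction x using List.reverseRecOn with
  | nil => intro _; rw [reach_nil]; rfl
  | append_singleton x b ih =>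
    intro hx
    simp only [List.length_append, List.length_singleton] at hx
    rw [reach_append_singleton, ih (by omega)]
    show (if x.length < N then x ++ [b] else x) = x ++ [b]
    rw [if_pos (by omega)]

/-- The truncating buffer decides `L`. [folklore] -/
theorem decides_truncBuffer (L : Language Bool) : (truncBuffer L).Decides L := fun x => by
  rw [StreamingAlgorithm.Accepts, finalState_eq_reach, reach_truncBuffer L _ x le_rfl]
  show L.boolIndicator x = true ↔ x ∈ L
  rw [← Set.mem_iff_boolIndicator]
  exact Iff.rfl

end TBuf

/-- **Every language is in `STREAM N (5N + 10)`.** [folklore] -/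
theorem mem_STREAM_id (L : Language Bool) :
    L ∈ STREAM (fun N => N) (fun N => 5 * N + 10) :=
  mem_STREAM_of_hasSpace ⟨_, TBuf.hasSpace_truncBuffer L, TBuf.decides_truncBuffer L⟩ fun _ => le_rfl

/-- **The non-uniform one-pass class at space `N` is the class of all languages.** [folklore] -/
theorem STREAM_id_eq_univ : STREAM (fun N => N) (fun N => 5 * N + 10) = Set.univ :=
  Set.eq_univ_of_forall mem_STREAM_id

/-- In particular `SAT ∈ STREAM N (5N + 10)`: no time-insensitive, uniformity-insensitive argument
separates `SAT` from one-pass space `N`. [folklore] -/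
theorem SAT_mem_STREAM_id : SAT ∈ STREAM (fun N => N) (fun N => 5 * N + 10) :=
  mem_STREAM_id SAT

end Summit.PneNP.PneNP.Theorems.SoloBlind
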